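import Summits.BirchSwinnertonDyer.BirchSwinnertonDyer.Theorems.KolyvaginRoadThreeMethod2Defs
import HarnessLib

/-!
# KOLY method line, crux stmt-BirchSwinnertonDyer-19574 `ZhangSharpFrameAtThreeHL`: MEMBERSHIP DICTIONARIES for the
# canonical spaces `levelSelmerSubgroup` ∕ `SelQ` ∕ `SelRelQ` of the method skeleton (cell `bsd-stepL`, seat
# `bsd-stepL-zhang3-p1` g8; `--supports 19574`, helper; item 2 of the S2-ENGINE work package, memo
# `HOME/zhang3/S2-RELINE-19574.md`)

Pure unfolding of `Method2Defs.levelSelmerSubgroup` (an `⊓` of four parts, two of them `⨅`s over places with side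
conditions): a class lies in the canonical level-`n` space relaxed at `S`, of sign `μ`, iff (i) complex conjugation acts
on it by `sgn μ`, (ii) it satisfies E's Kummer condition at every infinite place, (iii) E's Kummer condition at every
finite place above no prime of `n ∪ S`, and (iv) the ORDINARY condition at every place above a prime of `n ∖ S`. Stated
for `levelSelmerSubgroup` (levels as `Finset ℕ`), and for `SelQ` ∕ `SelRelQ` (levels as finite sets of
unipotent-admissible primes). These are the model side of the engine's membership dictionaries `hSel` ∕ `hSelRel`
(`ZhangTriangulation.exists_ne_zero_of_zhangInduction_on_of_kolyvaginSystem_finite*`,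
`Method2.inductionOfLevelSystems_of_engineInputs`). 0 definitions, 0 facts, 0 `sorry`; closes nothing (T7).

References: [cite: WZhang2014, §5 (Sel_{𝔭_n}), Lemma 8.4 (3) (relaxed Selmer group)] [cite: BertoliniDarmon2005, §2.3].
-/

noncomputable section

open scoped Classical

namespace Summit.BirchSwinnertonDyer.Rank1Residual.X11b.Three.Koly.Method2

open WeierstrassCurve NumberField IsDedekindDomain
  Literature.NumberTheory.EllipticCurves Literature.NumberTheory.EllipticCurves.ModularForms
  Literature.NumberTheory.GaloisRepresentations Module

variable (W : WeierstrassCurve ℚ) (K : Type) [Field K] [NumberField K] (c : K ≃ₐ[ℚ] K)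

/-- **Membership in the canonical space `levelSelmerSubgroup n S μ`** (definitional unfolding): sign `sgn μ` under
complex conjugation; Kummer at the infinite places; Kummer at the finite places above no prime of `n ∪ S`; ordinary at
the places above the primes of `n` not in `S`. [cite: WZhang2014, §5 (Sel_{𝔭_n})] -/
theorem mem_levelSelmerSubgroup_iff (n : Finset ℕ) (S : Set ℕ) (μ : Bool) (x : V3 W K) :
    x ∈ levelSelmerSubgroup W K c n S μ ↔
      conjAct W c ((3 ^ 1 : ℕ) : ℤ) x = sgn μ • x ∧
      (∀ w : InfinitePlace K, x ∈ selmerLocalKer (W.baseChange K) w.Completion ((3 ^ 1 : ℕ) : ℤ)) ∧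
      (∀ v : HeightOneSpectrum (𝓞 K), (∀ q ∈ (n : Set ℕ) ∪ S, (q : 𝓞 K) ∉ v.asIdeal) →
        x ∈ selmerLocalKer (W.baseChange K) (v.adicCompletion K) ((3 ^ 1 : ℕ) : ℤ)) ∧
      (∀ q : ℕ, q ∈ n ∧ q ∉ S → ∀ v : HeightOneSpectrum (𝓞 K), (q : 𝓞 K) ∈ v.asIdeal →
        x ∈ (W.baseChange K).ordinaryLocalKer (v.adicCompletion K) ((3 ^ 1 : ℕ) : ℤ)) := by
  unfold levelSelmerSubgroup
  simp only [AddSubgroup.mem_inf, AddSubgroup.mem_iInf, AddMonoidHom.mem_ker, AddMonoidHom.sub_apply, sub_eq_zero]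
  exact Iff.rfl

variable [W.IsGloballyMinimal] [Module (ZMod 3) (V3 W K)]

/-- **Membership in `SelQ n μ`** (`n` a finite set of unipotent-admissible primes): sign; Kummer at the infinite places;
Kummer at the finite places above no prime of `n`; ordinary at the places above the primes of `n`.
[cite: WZhang2014, §5 (Sel_{𝔭_n})] -/
theorem mem_selQ_iff (n : Finset {q // IsUAdmissiblePrime W K q}) (μ : Bool) (x : V3 W K) :
    x ∈ SelQ W K c n μ ↔
      conjAct W c ((3 ^ 1 : ℕ) : ℤ) x = sgn μ • x ∧
      (∀ w : InfinitePlace K, x ∈ selmerLocalKer (W.baseChange K) w.Completion ((3 ^ 1 : ℕ) : ℤ)) ∧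
      (∀ v : HeightOneSpectrum (𝓞 K), (∀ q ∈ n, ((q : ℕ) : 𝓞 K) ∉ v.asIdeal) →
        x ∈ selmerLocalKer (W.baseChange K) (v.adicCompletion K) ((3 ^ 1 : ℕ) : ℤ)) ∧
      (∀ q ∈ n, ∀ v : HeightOneSpectrum (𝓞 K), ((q : ℕ) : 𝓞 K) ∈ v.asIdeal →
        x ∈ (W.baseChange K).ordinaryLocalKer (v.adicCompletion K) ((3 ^ 1 : ℕ) : ℤ)) := by
  unfold SelQ
  rw [AddSubgroup.mem_toZModSubmodule, mem_levelSelmerSubgroup_iff]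
  refine and_congr_right fun _ ↦ and_congr_right fun _ ↦ ⟨fun ⟨h3, h4⟩ ↦ ⟨fun v hv ↦ ?_, fun q hq v hv ↦ ?_⟩,
    fun ⟨h3, h4⟩ ↦ ⟨fun v hv ↦ ?_, fun q hq v hv ↦ ?_⟩⟩
  · refine h3 v fun q' hq' ↦ ?_
    rcases hq' with hq' | hq'
    · obtain ⟨a, ha, rfl⟩ := Finset.mem_image.mp (Finset.mem_coe.mp hq')
      exact hv a ha
    · exact absurd hq' (Set.notMem_empty _)
  · exact h4 (q : ℕ) ⟨Finset.mem_image_of_mem _ hq, Set.notMem_empty _⟩ v hv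
  · exact h3 v fun a ha ↦ hv (a : ℕ) (Or.inl (Finset.mem_coe.mpr (Finset.mem_image_of_mem _ ha)))
  · obtain ⟨a, ha, rfl⟩ := Finset.mem_image.mp hq.1
    exact h4 a ha v hv

/-- **Membership in `SelRelQ n S μ`** (relaxed at the admissible primes of `S`): sign; Kummer at the infinite places;
Kummer at the finite places above no prime of `n ∪ S`; ordinary at the places above the primes of `n ∖ S`; NO
condition at the places above `S`. [cite: WZhang2014, Lemma 8.4 (3) (relaxed Selmer group)] -/
theorem mem_selRelQ_iff (n : Finset {q // IsUAdmissiblePrime W K q}) (S : Set {q // IsUAdmissiblePrime W K q})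
    (μ : Bool) (x : V3 W K) :
    x ∈ SelRelQ W K c n S μ ↔
      conjAct W c ((3 ^ 1 : ℕ) : ℤ) x = sgn μ • x ∧
      (∀ w : InfinitePlace K, x ∈ selmerLocalKer (W.baseChange K) w.Completion ((3 ^ 1 : ℕ) : ℤ)) ∧
      (∀ v : HeightOneSpectrum (𝓞 K), (∀ q ∈ n, ((q : ℕ) : 𝓞 K) ∉ v.asIdeal) →
        (∀ q ∈ S, ((q : ℕ) : 𝓞 K) ∉ v.asIdeal) →
        x ∈ selmerLocalKer (W.baseChange K) (v.adicCompletion K) ((3 ^ 1 : ℕ) : ℤ)) ∧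
      (∀ q ∈ n, q ∉ S → ∀ v : HeightOneSpectrum (𝓞 K), ((q : ℕ) : 𝓞 K) ∈ v.asIdeal →
        x ∈ (W.baseChange K).ordinaryLocalKer (v.adicCompletion K) ((3 ^ 1 : ℕ) : ℤ)) := by
  unfold SelRelQ
  rw [AddSubgroup.mem_toZModSubmodule, mem_levelSelmerSubgroup_iff]
  refine and_congr_right fun _ ↦ and_congr_right fun _ ↦ ⟨fun ⟨h3, h4⟩ ↦ ⟨fun v hv hvS ↦ ?_, fun q hq hqS v hv ↦ ?_⟩,
    fun ⟨h3, h4⟩ ↦ ⟨fun v hv ↦ ?_, fun q hq v hv ↦ ?_⟩⟩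
  · refine h3 v fun q' hq' ↦ ?_
    rcases hq' with hq' | hq'
    · obtain ⟨a, ha, rfl⟩ := Finset.mem_image.mp (Finset.mem_coe.mp hq')
      exact hv a ha
    · obtain ⟨a, ha, rfl⟩ := hq'
      exact hvS a ha
  · refine h4 (q : ℕ) ⟨Finset.mem_image_of_mem _ hq, fun h ↦ hqS ?_⟩ v hv
    obtain ⟨a, ha, hav⟩ := h
    rwa [← Subtype.ext hav]
  · exact h3 v (fun a ha ↦ hv (a : ℕ) (Or.inl (Finset.mem_coe.mpr (Finset.mem_image_of_mem _ ha))))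
      (fun a ha ↦ hv (a : ℕ) (Or.inr ⟨a, ha, rfl⟩))
  · obtain ⟨a, ha, rfl⟩ := Finset.mem_image.mp hq.1
    exact h4 a ha (fun haS ↦ hq.2 ⟨a, haS, rfl⟩) v hv

end Summit.BirchSwinnertonDyer.Rank1Residual.X11b.Three.Koly.Method2

end
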